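import Literature.InformationTheory.QuantumCodes.ToricCodePolygons
import HarnessLib

/-!
# Decoding failure of the toric code forces a long, half-faulty self-avoiding polygon
# (Dennis–Kitaev–Landahl–Preskill 2002, §5.2 — the coding half of the counting bound)

Topic `Literature/InformationTheory/QuantumCodes` (venture QEC, LADDER-QEC rung Q5). Third theorem
file towards the discharge of `ToricCode.failureProb_le_of_sawCountBound` (`ToricCodeThreshold.lean`).

DKLP §5.2: if minimum-weight recovery `E_min` of the `Z`-errors `E` of the `L × L` toric code
fails, then the cycle `E + E_min` is homologically non-trivial, so it "contains … a self-avoiding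
closed loop" that is itself non-trivial, hence has `H ≥ L` links, and "there can be no more than
`H/2` links [of `E_min`] on this path … and therefore there must be at least `H/2` links [of `E`]"
(eq. (e_ineq)). Proved here:

* `exists_polygon_subset` — **every non-empty link set meeting each site an even number of times
  contains a self-avoiding polygon** (longest self-avoiding lattice path inside the set: its last
  site has a second link in the set, which must close the path up on itself);
* `exists_polygon_not_mem_boundaries` — a homologically non-trivial cycle contains a homologically
  non-trivial self-avoiding polygon (peel off polygons; boundaries form a subspace);
* `card_le_two_mul_card_inter` — the half-weight inequality `H ≤ 2 |P ∩ E|` from the minimality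
  of `E_min` (eq. (e_ineq): flipping `E_min` along the cycle `P` cannot shorten it);
* **`exists_polygon_of_failure`** — failure of a minimum-weight decoder on `E` yields a
  self-avoiding polygon with `H ≥ L` links (given `cycle_weight_ge`, proved in
  `ToricCodeCycles.lean`) at least half of which are in `E`.

## References

* [DennisEtAl2002] E. Dennis, A. Kitaev, A. Landahl, J. Preskill, *Topological quantum memory*,
  J. Math. Phys. 43 (2002) 4452–4505, arXiv:quant-ph/0110143, §5.2 (eqs. (e_ineq)–(28)).
-/

namespace Literature.InformationTheory.QuantumCodes

namespace ToricCode

open Finset Matrix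
open Literature.Probability.LatticeModels (TorusSite Site Torus.proj)
open Literature.Probability.Percolation (stepVec)
open Literature.Probability.RandomPlanarGeometry.SAW.Zd

variable {L : ℕ}

/-! ### Arithmetic of `ℤ₂` and supports -/

/-- A non-zero element of `ℤ₂` is `1`. [folklore] -/
private theorem zmod2_eq_one_of_ne_zero {x : ZMod 2} (h : x ≠ 0) : x = 1 := by
  revert x; decide

/-- `x + y = 0 → x = y` in `ℤ₂`. [folklore] -/
private theorem zmod2_eq_of_add_eq_zero {x y : ZMod 2} (h : x + y = 0) : x = y := by
  revert x y; decide

/-- If `a + b ≠ 0` in `ℤ₂` then exactly one of them vanishes. [folklore] -/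
private theorem zmod2_eq_zero_iff_of_add_ne_zero {a b : ZMod 2} (h : a + b ≠ 0) : a = 0 ↔ b ≠ 0 := by
  revert a b; decide

/-- Membership in the support. [folklore] -/
private theorem mem_supp' [NeZero L] {x : Chain L} {ℓ : Edge L} : ℓ ∈ supp x ↔ x ℓ ≠ 0 := by
  simp [supp]

/-- A binary chain is the indicator of its support. [cite: DennisEtAl2002, §4.4 (n_E(ℓ) ∈ {0,1})] -/
private theorem eq_indicator_supp [NeZero L] (c : Chain L) (ℓ : Edge L) :
    c ℓ = if ℓ ∈ supp c then 1 else 0 := by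
  split_ifs with h
  · exact zmod2_eq_one_of_ne_zero (mem_supp'.1 h)
  · by_contra h'
    exact h (mem_supp'.2 h')

/-- A binary chain is the sum of the indicators of the links of its support.
[cite: DennisEtAl2002, §4.4 (n_E(ℓ) ∈ {0,1})] -/
private theorem eq_sum_single_supp [NeZero L] (c : Chain L) :
    c = ∑ ℓ ∈ supp c, (Pi.single ℓ (1 : ZMod 2) : Chain L) := by
  classical
  funext ℓ'
  rw [Finset.sum_apply, eq_indicator_supp c ℓ']
  simp only [Pi.single_apply]
  rw [Finset.sum_ite_eq]

/-! ### Even degrees -/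

/-- The boundary of a single link detects exactly its two (distinct, `L ≥ 2`) end sites:
`(H^X 𝟙_ℓ)_x = 1` iff `x ∈ {u, u + eᵢ}`. [cite: DennisEtAl2002, §4.3 (the boundary of a chain)] -/
private theorem starMatrix_mulVec_single_eq_ite [NeZero L] (hL : 2 ≤ L) (ℓ : Edge L) (x : Vertex L) :
    (starMatrix L *ᵥ Pi.single ℓ (1 : ZMod 2)) x = if x ∈ toSym2 ℓ then 1 else 0 := by
  classical
  rw [starMatrix_mulVec_single]
  simp only [Pi.single_apply, toSym2, Sym2.mem_iff]
  have hne : ℓ.1 ≠ ℓ.1 + dir ℓ.2 := by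
    intro h
    have h1 := congrFun h ℓ.2
    simp only [Pi.add_apply, dir, Pi.single_eq_same] at h1
    haveI : Fact (1 < L) := ⟨hL⟩
    exact one_ne_zero (left_eq_add.1 h1)
  by_cases h1 : x = ℓ.1
  · have h2 : x ≠ ℓ.1 + dir ℓ.2 := h1 ▸ hne
    simp [h1, hne]
  · by_cases h2 : x = ℓ.1 + dir ℓ.2
    · simp [h2, hne.symm]
    · simp [h1, h2]

/-- **A cycle meets every site an even number of times**: for `c ∈ cycles`, the number of links
of `c` having `x` as an end site is even. [cite: DennisEtAl2002, §4.3 (a cycle has no boundary)] -/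
theorem even_card_filter_of_mem_cycles [NeZero L] (hL : 2 ≤ L) {c : Chain L} (hc : c ∈ cycles L)
    (x : Vertex L) : Even (((supp c).filter fun ℓ => x ∈ toSym2 ℓ).card) := by
  classical
  have h := congrFun hc x
  change (starMatrix L *ᵥ c) x = 0 at h
  rw [eq_sum_single_supp c, Matrix.mulVec_sum, Finset.sum_apply] at h
  simp only [starMatrix_mulVec_single_eq_ite hL] at h
  rw [Finset.sum_boole] at h
  exact (ZMod.natCast_eq_zero_iff_even.1 h)

/-! ### Self-avoiding lattice paths on the torus -/

/-- A self-avoiding lattice path on the torus: the sites `0, …, |w|` are distinct.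
[cite: DennisEtAl2002, §5.2 (self-avoiding paths on the lattice)] -/
def IsTorusSAW (v : Vertex L) (w : List (Fin 2 × Bool)) : Prop :=
  ∀ i j, i ≤ w.length → j ≤ w.length → tpos v w i = tpos v w j → i = j

/-- A self-avoiding lattice path has fewer steps than there are sites.
[cite: DennisEtAl2002, §5.2 (self-avoiding paths on the lattice)] -/
theorem IsTorusSAW.length_lt [NeZero L] {v : Vertex L} {w : List (Fin 2 × Bool)}
    (h : IsTorusSAW v w) : w.length < Fintype.card (Vertex L) := by
  have hinj : Function.Injective (fun i : Fin (w.length + 1) => tpos v w i) := by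
    intro i j hij
    exact Fin.ext (h i j (Nat.le_of_lt_succ i.2) (Nat.le_of_lt_succ j.2) hij)
  have := Fintype.card_le_of_injective _ hinj
  rw [Fintype.card_fin] at this
  omega

/-- The step of `ℤ²` reduces to a non-zero vector on the torus (`L ≥ 2`). [folklore] -/
private theorem proj_stepVec_ne_zero (hL : 2 ≤ L) (a : Fin 2 × Bool) :
    (Torus.proj L (stepVec a) : Vertex L) ≠ 0 := by
  obtain ⟨i, b⟩ := a
  intro h
  have h1 := congrFun h i
  haveI : Fact (1 < L) := ⟨hL⟩
  cases b <;> simp [Torus.proj, stepVec] at h1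

/-- From an end site `x` of a link `ℓ` there is a step traversing `ℓ`.
[cite: DennisEtAl2002, §5.2 (links of a lattice path)] -/
private theorem exists_step_of_mem_toSym2 {x : Vertex L} {ℓ : Edge L} (h : x ∈ toSym2 ℓ) :
    ∃ a : Fin 2 × Bool, stepEdge x a = ℓ := by
  obtain ⟨u, i⟩ := ℓ
  simp only [toSym2, Sym2.mem_iff] at h
  rcases h with rfl | rfl
  · exact ⟨(i, true), by simp [stepEdge]⟩
  · exact ⟨(i, false), by simp [stepEdge]⟩

/-- **A non-empty link set meeting every site an even number of times contains a self-avoiding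
polygon** (`L ≥ 3`). Take a longest self-avoiding lattice path whose links lie in `S`; its last
site carries a second link of `S`, and the step along it must revisit an earlier site (by
maximality), not the previous one (that would be the same link), closing up a polygon.
[cite: DennisEtAl2002, §5.2 ("this cycle contains … a self-avoiding closed loop")] -/
theorem exists_polygon_subset [NeZero L] (hL : 3 ≤ L) (S : Finset (Edge L)) (hne : S.Nonempty)
    (hdeg : ∀ x : Vertex L, Even ((S.filter fun ℓ => x ∈ toSym2 ℓ).card)) :
    ∃ (v : Vertex L) (w : List (Fin 2 × Bool)), IsPolygon v w ∧ polygonEdges v w ⊆ S := by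
  classical
  set N := Fintype.card (Vertex L) with hN
  set A : Finset (Vertex L × List (Fin 2 × Bool)) :=
    ((univ : Finset (Vertex L)) ×ˢ (range N).biUnion (fun n => Word.words 2 n)).filter
      (fun vw => IsTorusSAW vw.1 vw.2 ∧ polygonEdges vw.1 vw.2 ⊆ S) with hA
  have hmemA : ∀ (v : Vertex L) (w : List (Fin 2 × Bool)),
      IsTorusSAW v w → polygonEdges v w ⊆ S → (v, w) ∈ A := by
    intro v w h1 h2
    rw [hA, Finset.mem_filter, Finset.mem_product, Finset.mem_biUnion]
    exact ⟨⟨Finset.mem_univ _, w.length, Finset.mem_range.2 h1.length_lt, Word.mem_words.2 rfl⟩, h1, h2⟩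
  -- the one-link paths show `A` has an element of length 1
  obtain ⟨ℓ₀, hℓ₀⟩ := hne
  have h1A : (ℓ₀.1, [(ℓ₀.2, true)]) ∈ A := by
    refine hmemA _ _ ?_ ?_
    · intro i j hi hj hij
      simp only [List.length_singleton] at hi hj
      rcases Nat.le_one_iff_eq_zero_or_eq_one.1 hi with rfl | rfl <;>
        rcases Nat.le_one_iff_eq_zero_or_eq_one.1 hj with rfl | rfl
      · rfl
      · exfalso
        rw [tpos_zero, tpos_succ _ _ (by simp)] at hij
        simp only [tpos_zero, List.getElem_cons_zero, left_eq_add] at hij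
        exact proj_stepVec_ne_zero (by omega) _ hij
      · exfalso
        rw [tpos_zero, tpos_succ _ _ (by simp)] at hij
        simp only [tpos_zero, List.getElem_cons_zero, add_eq_left] at hij
        exact proj_stepVec_ne_zero (by omega) _ hij
      · rfl
    · intro ℓ hℓ
      rw [polygonEdges, Finset.mem_image] at hℓ
      obtain ⟨k, hk, rfl⟩ := hℓ
      simp only [List.length_singleton, Finset.mem_range, Nat.lt_one_iff] at hk
      subst hk
      simpa [edgeAt, stepEdge] using hℓ₀
  have hAne : A.Nonempty := ⟨_, h1A⟩
  obtain ⟨⟨v, w⟩, hvw, hmax⟩ := A.exists_max_image (fun vw => vw.2.length) hAne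
  dsimp only at hvw hmax
  rw [hA, Finset.mem_filter] at hvw
  obtain ⟨-, hsaw, hsub⟩ := hvw
  dsimp only at hsaw hsub
  have hm1 : 1 ≤ w.length := by simpa using hmax _ h1A
  -- the last link and a second link of `S` at the last site `x`
  set m := w.length with hm
  set x := tpos v w m with hx
  have hlast : edgeAt v w (m - 1) ∈ S :=
    hsub (Finset.mem_image.2 ⟨m - 1, Finset.mem_range.2 (by omega), rfl⟩)
  have hxlast : x ∈ toSym2 (edgeAt v w (m - 1)) := by
    rw [toSym2_edgeAt v w (by omega), show m - 1 + 1 = m by omega, Sym2.mem_iff]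
    exact Or.inr rfl
  obtain ⟨ℓ', hℓ'F, hne'⟩ : ∃ ℓ' ∈ S.filter (fun ℓ => x ∈ toSym2 ℓ), ℓ' ≠ edgeAt v w (m - 1) := by
    refine Finset.exists_mem_ne ?_ _
    have hin : edgeAt v w (m - 1) ∈ S.filter (fun ℓ => x ∈ toSym2 ℓ) :=
      Finset.mem_filter.2 ⟨hlast, hxlast⟩
    obtain ⟨r, hr⟩ := hdeg x
    have hpos : 0 < (S.filter (fun ℓ => x ∈ toSym2 ℓ)).card := Finset.card_pos.2 ⟨_, hin⟩
    omega
  rw [Finset.mem_filter] at hℓ'F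
  obtain ⟨hℓ'S, hxℓ'⟩ := hℓ'F
  obtain ⟨a', ha'⟩ := exists_step_of_mem_toSym2 hxℓ'
  -- the extended path
  set w' := w ++ [a'] with hw'
  have hlen' : w'.length = m + 1 := by simp [hw', hm]
  have htpos' : ∀ i, i ≤ m → tpos v w' i = tpos v w i := fun i hi => tpos_append_left v w [a'] hi
  have hy : tpos v w' (m + 1) = x + Torus.proj L (stepVec a') := by
    have := tpos_append_right v w [a'] 1
    rw [← hm] at this
    rw [this, tpos_succ _ _ (by simp), tpos_zero]
    simp [hx]
  have hedge' : ∀ k, k < m → edgeAt v w' k = edgeAt v w k := fun k hk => edgeAt_append_left v w [a'] hk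
  have hedgem : edgeAt v w' m = ℓ' := by
    rw [hw', hm, edgeAt_append_single, ← hx, ha']
  have hsub' : polygonEdges v w' ⊆ S := by
    intro ℓ hℓ
    rw [polygonEdges, Finset.mem_image] at hℓ
    obtain ⟨k, hk, rfl⟩ := hℓ
    rw [Finset.mem_range, hlen'] at hk
    rcases lt_or_eq_of_le (Nat.le_of_lt_succ hk) with hk' | rfl
    · rw [hedge' k hk']
      exact hsub (Finset.mem_image.2 ⟨k, Finset.mem_range.2 hk', rfl⟩)
    · rw [hedgem]; exact hℓ'S
  -- by maximality the extended path is not self-avoiding: its new site is an old one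
  have hnot : ¬ IsTorusSAW v w' := by
    intro h
    have := hmax _ (hmemA v w' h hsub')
    simp [hlen'] at this
  obtain ⟨i, him, hiy⟩ : ∃ i, i ≤ m ∧ tpos v w' (m + 1) = tpos v w i := by
    simp only [IsTorusSAW, not_forall, exists_prop] at hnot
    obtain ⟨i, j, hi, hj, hij, hne⟩ := hnot
    rw [hlen'] at hi hj
    rcases lt_or_eq_of_le hi with hi' | rfl
    · rcases lt_or_eq_of_le hj with hj' | rfl
      · exact absurd (hsaw i j (by omega) (by omega) (by rwa [htpos' i (by omega), htpos' j (by omega)] at hij)) hne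
      · exact ⟨i, by omega, by rw [← hij, htpos' i (by omega)]⟩
    · rcases lt_or_eq_of_le hj with hj' | rfl
      · exact ⟨j, by omega, by rw [hij, htpos' j (by omega)]⟩
      · exact absurd rfl hne
  -- the revisited site is neither the last site nor the one before it
  have hi_ne_m : i ≠ m := by
    rintro rfl
    rw [hy, ← hx, add_eq_left] at hiy
    exact proj_stepVec_ne_zero (by omega) a' hiy
  have hi_ne_pred : i ≠ m - 1 := by
    rintro rfl
    apply hne'
    rw [← ha']
    apply toSym2_injective hL
    rw [toSym2_stepEdge, toSym2_edgeAt v w (by omega), show m - 1 + 1 = m by omega, ← hx, ← hy, hiy,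
      Sym2.eq_swap]
  have hi2 : i + 2 ≤ m := by omega
  -- the polygon: from the site `i`, the rest of the extended path
  have hdropLen : (w'.drop i).length = m + 1 - i := by rw [List.length_drop, hlen']
  have htposD : ∀ k, tpos (tpos v w i) (w'.drop i) k = tpos v w' (i + k) := by
    intro k
    rw [← htpos' i him]
    exact tpos_drop v w' (by rw [hlen']; omega) k
  refine ⟨tpos v w i, w'.drop i, ⟨?_, ?_, ?_⟩, ?_⟩
  · rw [hdropLen]; omega
  · rw [hdropLen, htposD, show i + (m + 1 - i) = m + 1 by omega, hiy]
  · intro k k' hk hk' hkk'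
    rw [hdropLen] at hk hk'
    rw [htposD, htposD, htpos' _ (by omega), htpos' _ (by omega)] at hkk'
    have := hsaw _ _ (by omega) (by omega) hkk'
    omega
  · intro ℓ hℓ
    rw [polygonEdges, Finset.mem_image] at hℓ
    obtain ⟨k, hk, rfl⟩ := hℓ
    rw [Finset.mem_range, hdropLen] at hk
    rw [← htpos' i him, edgeAt_drop v w' (by rw [hlen']; omega)]
    exact hsub' (Finset.mem_image.2 ⟨i + k, Finset.mem_range.2 (by rw [hlen']; omega), rfl⟩)

/-! ### A non-trivial cycle contains a non-trivial polygon -/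

/-- Adding the chain of a polygon contained in the support of `c` removes exactly its links.
[cite: DennisEtAl2002, §4.4 (chains add modulo 2)] -/
private theorem supp_add_polygonChain [NeZero L] {c : Chain L} {v : Vertex L} {w : List (Fin 2 × Bool)}
    (hP : IsPolygon v w) (hsub : polygonEdges v w ⊆ supp c) :
    supp (c + polygonChain v w) = supp c \ polygonEdges v w := by
  classical
  ext ℓ
  rw [Finset.mem_sdiff, mem_supp', mem_supp', Pi.add_apply, polygonChain_apply hP.edgeAt_injOn]
  by_cases h : ℓ ∈ polygonEdges v w
  · have hc : c ℓ = 1 := zmod2_eq_one_of_ne_zero (mem_supp'.1 (hsub h))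
    simp only [h, if_true, hc, not_true_eq_false, and_false, iff_false, not_not]
    decide
  · simp [h]

/-- **A homologically non-trivial cycle contains a homologically non-trivial self-avoiding
polygon** (`L ≥ 3`): peel self-avoiding polygons off the cycle; since boundaries form a subspace,
one of them is non-trivial. [cite: DennisEtAl2002, §5.2 ("E + E_min contains … a homologically nontrivial self-avoiding closed loop")] -/
theorem exists_polygon_not_mem_boundaries [NeZero L] (hL : 3 ≤ L) {c : Chain L}
    (hc : c ∈ cycles L) (hnb : c ∉ boundaries L) :
    ∃ (v : Vertex L) (w : List (Fin 2 × Bool)), IsPolygon v w ∧ polygonEdges v w ⊆ supp c ∧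
      polygonChain v w ∉ boundaries L := by
  classical
  induction hn : (supp c).card using Nat.strong_induction_on generalizing c with
  | _ n ih =>
  -- `c ≠ 0`, so its support is non-empty
  have hne : (supp c).Nonempty := by
    rw [Finset.nonempty_iff_ne_empty]
    intro h0
    apply hnb
    have : c = 0 := by
      funext ℓ
      by_contra h
      have : ℓ ∈ supp c := mem_supp'.2 h
      rw [h0] at this
      exact Finset.notMem_empty _ this
    rw [this]
    exact (rowSpace (plaquetteMatrix L)).zero_mem
  have hdeg := even_card_filter_of_mem_cycles (by omega) hc
  obtain ⟨v, w, hP, hsub⟩ := exists_polygon_subset hL (supp c) hne hdeg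
  by_cases hq : polygonChain v w ∈ boundaries L
  · -- peel it off and recurse
    have hqc : polygonChain v w ∈ cycles L := polygonChain_mem_cycles hP.closed
    set c' := c + polygonChain v w with hc'
    have hc'c : c' ∈ cycles L := by
      change syn L c' = 0
      have h1 : syn L c = 0 := hc
      have h2 : syn L (polygonChain v w) = 0 := hqc
      unfold syn at h1 h2 ⊢
      rw [hc', Matrix.mulVec_add, h1, h2, add_zero]
    have hc'nb : c' ∉ boundaries L := by
      intro h
      apply hnb
      have : c = c' - polygonChain v w := by rw [hc', add_sub_cancel_right]
      rw [this]
      exact (rowSpace (plaquetteMatrix L)).sub_mem h hq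
    have hcard : (supp c').card < n := by
      rw [← hn, hc', supp_add_polygonChain hP hsub, Finset.card_sdiff_of_subset hsub, hP.card_polygonEdges]
      have h3 := hP.three_le
      have : (polygonEdges v w).card ≤ (supp c).card := Finset.card_le_card hsub
      rw [hP.card_polygonEdges] at this
      omega
    obtain ⟨v', w', hP', hsub', hq'⟩ := ih _ hcard hc'c hc'nb rfl
    refine ⟨v', w', hP', hsub'.trans ?_, hq'⟩
    rw [hc', supp_add_polygonChain hP hsub]
    exact Finset.sdiff_subset
  · exact ⟨v, w, hP, hsub, hq⟩

/-! ### At least half of the links of the polygon are faulty -/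

/-- **The half-weight inequality** (DKLP eq. (e_ineq)): if `E'` is a minimum-weight chain in its
syndrome class — `|E'| ≤ |E' + 𝟙_P|` for the cycle `P` — and `P ⊆ supp(E' + E)`, then at least
half of the links of `P` lie in `E` ("there can be no more than `H/2` links [of `E_min`] on this
path … therefore there must be at least `H/2` links [of `E`]").
[cite: DennisEtAl2002, §5.2 eq. (e_ineq)] -/
theorem card_le_two_mul_card_inter [NeZero L] {e e' q : Chain L} {P : Finset (Edge L)}
    (hq : ∀ ℓ, q ℓ = if ℓ ∈ P then 1 else 0) (hPc : P ⊆ supp (e' + e))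
    (hmin : hammingNorm e' ≤ hammingNorm (e' + q)) : P.card ≤ 2 * (P ∩ supp e).card := by
  classical
  have hx_off : supp (e' + q) \ P = supp e' \ P := by
    ext ℓ
    simp only [Finset.mem_sdiff, mem_supp', Pi.add_apply]
    constructor
    · rintro ⟨h1, h2⟩
      rw [hq ℓ, if_neg h2, add_zero] at h1
      exact ⟨h1, h2⟩
    · rintro ⟨h1, h2⟩
      rw [hq ℓ, if_neg h2, add_zero]
      exact ⟨h1, h2⟩
  have hx_on : supp (e' + q) ∩ P = P ∩ supp e := by
    ext ℓ
    simp only [Finset.mem_inter, mem_supp', Pi.add_apply]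
    constructor
    · rintro ⟨h1, h2⟩
      refine ⟨h2, ?_⟩
      have hee : e' ℓ + e ℓ ≠ 0 := mem_supp'.1 (hPc h2)
      rw [hq ℓ, if_pos h2] at h1
      have he' : e' ℓ = 0 := by
        have : e' ℓ + 1 ≠ 0 := h1
        revert this; generalize e' ℓ = a; revert a; decide
      exact (zmod2_eq_zero_iff_of_add_ne_zero hee).1 he'
    · rintro ⟨h2, h1⟩
      refine ⟨?_, h2⟩
      have hee : e' ℓ + e ℓ ≠ 0 := mem_supp'.1 (hPc h2)
      have he' : e' ℓ = 0 := by
        by_contra h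
        have := (zmod2_eq_zero_iff_of_add_ne_zero (by rwa [add_comm] at hee)).2 h
        exact h1 this
      rw [hq ℓ, if_pos h2, he', zero_add]
      exact one_ne_zero
  have he'_on : supp e' ∩ P = P \ supp e := by
    ext ℓ
    simp only [Finset.mem_inter, Finset.mem_sdiff, mem_supp']
    constructor
    · rintro ⟨h1, h2⟩
      have hee : e' ℓ + e ℓ ≠ 0 := mem_supp'.1 (hPc h2)
      refine ⟨h2, ?_⟩
      rw [not_not]
      by_contra h
      exact h1 ((zmod2_eq_zero_iff_of_add_ne_zero hee).2 h)
    · rintro ⟨h2, h1⟩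
      have hee : e' ℓ + e ℓ ≠ 0 := mem_supp'.1 (hPc h2)
      rw [not_not] at h1
      refine ⟨?_, h2⟩
      intro h
      exact ((zmod2_eq_zero_iff_of_add_ne_zero hee).1 h) h1
  have h1 : (supp (e' + q)).card = (supp e' \ P).card + (P ∩ supp e).card := by
    rw [← Finset.card_sdiff_add_card_inter (supp (e' + q)) P, hx_off, hx_on]
  have h2 : (supp e').card = (supp e' \ P).card + (P \ supp e).card := by
    rw [← Finset.card_sdiff_add_card_inter (supp e') P, he'_on]
  have h3 : (P \ supp e).card + (P ∩ supp e).card = P.card := Finset.card_sdiff_add_card_inter P (supp e)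
  have hmin' : (supp e').card ≤ (supp (e' + q)).card := hmin
  omega

/-- **Failure of minimum-weight decoding forces a long half-faulty self-avoiding polygon.** If a
minimum-weight decoder `D` fails on the `Z`-error chain `E` of the `L × L` toric code (`L ≥ 3`),
there is a self-avoiding polygon with `H ≥ L` links, at least half of which carry errors of `E`
(given `cycle_weight_ge`, the length bound for non-trivial cycles, proved in `ToricCodeCycles.lean`).
[cite: DennisEtAl2002, §5.2 (H ≥ L and eq. (e_ineq))] -/
theorem exists_polygon_of_failure [NeZero L] (hL : 3 ≤ L) (hcw : cycle_weight_ge) {D : ZDecoder L}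
    (hD : D.IsMinWeight (syn L) (cycles L) hammingNorm) {e : Chain L}
    (hfail : ¬ D.Corrects (syn L) (boundaries L) e) :
    ∃ (v : Vertex L) (w : List (Fin 2 × Bool)), IsPolygon v w ∧ L ≤ w.length ∧
      w.length ≤ 2 * (polygonEdges v w ∩ supp e).card := by
  classical
  set e' := D (syn L e) with he'
  have hc : e' + e ∈ cycles L := hD.add_mem e
  have hnb : e' + e ∉ boundaries L := hfail
  obtain ⟨v, w, hP, hsub, hq⟩ := exists_polygon_not_mem_boundaries hL hc hnb
  have hqc : polygonChain v w ∈ cycles L := polygonChain_mem_cycles hP.closed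
  refine ⟨v, w, hP, ?_, ?_⟩
  · have := hcw L (polygonChain v w) hqc hq
    rwa [hammingNorm_polygonChain hP] at this
  · -- minimality of `e'` against `e' + 𝟙_P`, which has the same syndrome
    have hsyn : syn L (e' + polygonChain v w) = syn L e := by
      have h1 : syn L (e' + e) = 0 := hc
      have h2 : syn L (polygonChain v w) = 0 := hqc
      unfold syn at h1 h2 ⊢
      rw [Matrix.mulVec_add, h2, add_zero]
      rw [Matrix.mulVec_add] at h1
      funext x
      exact zmod2_eq_of_add_eq_zero (congrFun h1 x)
    have hmin : hammingNorm e' ≤ hammingNorm (e' + polygonChain v w) := by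
      have := hD.weight_le (e' + polygonChain v w)
      rwa [hsyn] at this
    rw [← hP.card_polygonEdges]
    exact card_le_two_mul_card_inter (polygonChain_apply hP.edgeAt_injOn) hsub hmin

end ToricCode

end Literature.InformationTheory.QuantumCodes
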